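/-
Copyright (c) 2026 the pub-hodgecm-mathlib formalisation cell (harness21).  Prover seat hodgecm-mathlib-A-p06 (g28) — (U) road brick (b1)∕U1, FILE B (LEAD T9-34 (2); owner A-p19 (g24)).
-/
import Literature.NumberTheory.Weil1964.UnitaryArchLocalCayleyChart            -- FILE A (A-p06 g28): `skewC`, `cayleySourceC`, `cayleyChartC`, `cayleyInvC`
import Literature.NumberTheory.Automorphic.UnitaryFormGroupUnimodular         -- ★ `locallyCompactSpace_unitaryGroupOfForm_complex`, `isClosed_…`, `secondCountableTopology_…`
import Mathlib.MeasureTheory.Measure.Haar.OfBasis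
import Mathlib.MeasureTheory.Measure.Lebesgue.EqHaar
import HarnessLib

/-!
# The top-form-normalised Haar measure of ONE archimedean factor `U(Jw)(ℂ)`: the per-place trace-form Lebesgue measure on `𝔲(Jw) ⊂ M_N(ℂ)` transported through the
# per-place Cayley window ((U) road, brick U1 = CENSUS-Jval (b1), FILE B; Rogawski 1990 §1.7 «`dg = |Ω|_v`»; Helgason 2000 Ch. I §1 Thm. 1.14; Macdonald 1980)

Topic `NumberTheory/Weil1964` (the D-T road's measure bricks), namespace `Literature.NumberTheory.Weil1964.UnitaryArchLocalTopForm`.  FILE B of brick U1: DEFINITIONS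
WITH BODIES (`traceFormC`, `lieGramC`, `lieFinBasisC`, `lieGramDetC`, `lieStdLebesgueC`, `skewMulLC`, `cayleyWeightC`, `windowRadiusC`, `windowC`, `cayleyChartMeasureC`,
`localTopFormHaar`, `archLocalTopFormHaar`) and proved theorems; no named fact (net debt 0), no instance, no notation, no `sorry`.  Cell `pub/hodgecm-mathlib`, crux H413 =
`stmt-HodgeConjecture-24833` (supports only); (U) road (LEAD T9-32 (4), T9-34 (2); owner A-p19 (g24); source census `F0/P3/F0P3-p03/g10/CENSUS-Jval-ArchCovolumeRatio.F0P3p03g10.md`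
§1 (b1); my census `F0/P3a/A-p06/g28/CENSUS-U-b1-ArchLocalTopFormHaar.A-p06g28.md`, design B′).
HONEST LABEL: HC_CM is proved only modulo the 2 remaining named inputs (hLiu418 24832, h413 24833) until rung 0 closes; this file NAMES a measure per place and proves
it is a Haar measure — it discharges no printed statement.

THE DESIGN = THE ★ GLOBAL FILE `Weil1964/UnitaryArchTopFormHaar` (A-p19 (g20), D-T3′) READ AT ONE COMPLEX PLACE (`M_N(E ⊗ ℝ) ↦ M_N(ℂ)`, `(σX)ᵀ ↦ Xᴴ`, `reTr ↦ Re`):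
(§1) the real trace form `β(X, Y) = Re tr(XY)`, its Gram matrix on a real basis of `𝔲(Jw) = skewC N Jw` (FILE A) and the BASIS-FREE Lebesgue measure
**`lieStdLebesgueC N Jw := √|det β(B_i, B_j)| • B.addHaar`**; (§2) `m_Y : H ↦ (1 − Y) H (1 + Y)` on `𝔲(Jw)`, the weight `cayleyWeightC Y = |det m_Y|⁻¹`, the window, the chart measure
`cayleyChartMeasureC lam V₀ = ĉ_*(w₀ · lam|_{V₀})`; (§3) **`localTopFormHaar N Jw := (ν(W) ∕ haar(ĉ '' W)) • Measure.haar`** on `↥(unitaryGroupOfForm (starRingEnd ℂ) Jw)` — a Haar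
measure (`isHaarMeasure_localTopFormHaar`, under `lieGramDetC ≠ 0` = the global file's `hnd`) with `localTopFormHaar (ĉ '' W) = ν(W)` BY DEFINITION; FILE C reads it on
★ `archLocal L N H w` as `archLocalTopFormHaar L N H w`.  NOT HERE (design B′; owner's note «do NOT re-run ★ B5b locally»): the per-place Jacobian cocycle and window
identity — they follow by slicing the PRODUCT THEOREM (U2) proved from the ★ GLOBAL window identity and the factorisations `𝔲 ≃ Π_w 𝔲_w`, `β = Σ_w β_w` (★ `traceForm_eq_sum`).

## References
* J. D. Rogawski, *Automorphic Representations of Unitary Groups in Three Variables*, Ann. of Math. Stud. 123 (1990), §1.7 p. 6. [Rogawski1990]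
* S. Helgason, *Groups and Geometric Analysis*, AMS Math. Surveys Monogr. 83 (2000), Ch. I §1 Thm. 1.14 p. 96. [Helgason2000]
* I. G. Macdonald, *The volume of a compact Lie group*, Invent. Math. 56 (1980), 93–95. [Macdonald1980]
-/

set_option autoImplicit false
-- the scoped normed structure on the submodule `𝔲(Jw) ≤ M_N(ℂ)` is only reducibly defeq to the subtype uniformity ∕ topology carried by the
-- `[BorelSpace ↥(skewC …)]` binder (as in ★ `Weil1964/UnitaryArchTopFormHaar`, ★ `UnitaryGroupArchCayleyHaar`)
set_option backward.isDefEq.respectTransparency false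

noncomputable section

open Set Filter Topology MeasureTheory MeasureTheory.Measure Literature.Analysis.Calculus NumberField
open scoped Classical Matrix Matrix.Norms.Operator MatrixGroups ENNReal NNReal Pointwise

namespace Literature.NumberTheory.Weil1964

namespace UnitaryArchLocalTopForm

open Literature.NumberTheory.Automorphic Literature.NumberTheory.Automorphic.UnitaryGroup

/-! ## §1 The real trace form on `M_N(ℂ)` and the canonical Lebesgue measure on `𝔲(Jw)` -/

section TraceForm

variable (N : ℕ) (Jw : Matrix (Fin N) (Fin N) ℂ)

/-- **The real trace form** `β(X, Y) = Re tr(X Y)` on `M_N(ℂ)`, as an `ℝ`-bilinear map (the one-place summand of ★ `traceForm`, ★ `traceForm_eq_sum`).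
[cite: Macdonald1980, p. 93] [cite: Rogawski1990, §1.7 p. 6] -/
def traceFormC : Matrix (Fin N) (Fin N) ℂ →ₗ[ℝ] Matrix (Fin N) (Fin N) ℂ →ₗ[ℝ] ℝ :=
  LinearMap.mk₂ ℝ (fun X Y => (Matrix.trace (X * Y)).re)
    (fun X₁ X₂ Y => by simp only [add_mul, Matrix.trace_add, Complex.add_re])
    (fun t X Y => by simp only [smul_mul_assoc, Matrix.trace_smul, Complex.real_smul, Complex.re_ofReal_mul, smul_eq_mul])
    (fun X Y₁ Y₂ => by simp only [mul_add, Matrix.trace_add, Complex.add_re])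
    (fun t X Y => by simp only [mul_smul_comm, Matrix.trace_smul, Complex.real_smul, Complex.re_ofReal_mul, smul_eq_mul])

variable {N}

/-- Unfolding `traceFormC`. [cite: Macdonald1980, p. 93] -/
theorem traceFormC_apply (X Y : Matrix (Fin N) (Fin N) ℂ) : traceFormC N X Y = (Matrix.trace (X * Y)).re := rfl
variable {Jw}

/-- The Gram matrix of the trace form on a family of elements of `𝔲(Jw)`. [cite: Macdonald1980, p. 93] -/
def lieGramC {ι : Type} (B : ι → skewC N Jw) : Matrix ι ι ℝ :=
  Matrix.of fun i j => traceFormC N (B i : Matrix (Fin N) (Fin N) ℂ) (B j : Matrix (Fin N) (Fin N) ℂ)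

/-- Entries of the Gram matrix. [cite: Macdonald1980, p. 93] -/
theorem lieGramC_apply {ι : Type} (B : ι → skewC N Jw) (i j : ι) :
    lieGramC B i j = traceFormC N (B i : Matrix (Fin N) (Fin N) ℂ) (B j : Matrix (Fin N) (Fin N) ℂ) := rfl
/-- **Change of basis for the Gram matrix**: `Gram(v) = Pᵀ · Gram(B) · P` with `P = B.toMatrix v`. [cite: Macdonald1980, p. 93] -/
theorem lieGramC_basis_change {ι : Type} [Fintype ι] (B : Module.Basis ι ℝ (skewC N Jw)) (v : ι → skewC N Jw) :
    lieGramC v = (B.toMatrix v)ᵀ * lieGramC B * B.toMatrix v := by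
  ext i j
  have hvi : (v i : Matrix (Fin N) (Fin N) ℂ) = ∑ k, B.toMatrix v k i • (B k : Matrix (Fin N) (Fin N) ℂ) := by
    conv_lhs => rw [← B.sum_toMatrix_smul_self v i]
    rw [Submodule.coe_sum]; rfl
  have hvj : (v j : Matrix (Fin N) (Fin N) ℂ) = ∑ l, B.toMatrix v l j • (B l : Matrix (Fin N) (Fin N) ℂ) := by
    conv_lhs => rw [← B.sum_toMatrix_smul_self v j]
    rw [Submodule.coe_sum]; rfl
  rw [lieGramC_apply, hvi, hvj, _root_.map_sum (traceFormC N _), Matrix.mul_apply]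
  refine Finset.sum_congr rfl fun l _ => ?_
  rw [LinearMap.map_smul, _root_.map_sum (traceFormC N), LinearMap.sum_apply, Matrix.mul_apply, smul_eq_mul]
  simp only [LinearMap.map_smul, LinearMap.smul_apply, smul_eq_mul, Matrix.transpose_apply, lieGramC_apply]
  exact mul_comm _ _

/-- `M_N(ℂ)` is finite-dimensional over `ℝ` (put in the context by hand under the scoped operator-norm structure, as in the global file). [cite: Knapp2002, VIII §2] -/
theorem finiteDimensional_matrixC : FiniteDimensional ℝ (Matrix (Fin N) (Fin N) ℂ) := Module.Finite.matrix

variable (N Jw)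

/-- A basis of `𝔲(Jw)` indexed by `Fin (finrank)` (the one the definitions use; any other basis gives the same measure, `lieStdLebesgueC_eq_smul_addHaar`). [cite: Knapp2002, VIII §2] -/
def lieFinBasisC : Module.Basis (Fin (Module.finrank ℝ (skewC N Jw))) ℝ (skewC N Jw) :=
  haveI : FiniteDimensional ℝ (Matrix (Fin N) (Fin N) ℂ) := finiteDimensional_matrixC
  Module.finBasis ℝ (skewC N Jw)

/-- The Gram determinant of the trace form on `𝔲(Jw)` in the basis of record. [cite: Macdonald1980, p. 93] -/
def lieGramDetC : ℝ := (lieGramC (lieFinBasisC N Jw)).det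
variable [MeasurableSpace (skewC N Jw)] [BorelSpace (skewC N Jw)]

/-- **THE CANONICAL LEBESGUE MEASURE ON `𝔲(Jw)`**: `√|det β(B_i, B_j)| • B.addHaar` (basis-free: `lieStdLebesgueC_eq_smul_addHaar`). [cite: Macdonald1980, p. 93] [cite: Rogawski1990, §1.7 p. 6] -/
def lieStdLebesgueC : Measure (skewC N Jw) :=
  ENNReal.ofReal (Real.sqrt |lieGramDetC N Jw|) • (lieFinBasisC N Jw).addHaar

variable {N Jw}

/-- Unfolding `lieStdLebesgueC`. [cite: Macdonald1980, p. 93] -/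
theorem lieStdLebesgueC_def :
    lieStdLebesgueC N Jw = ENNReal.ofReal (Real.sqrt |(lieGramC (lieFinBasisC N Jw)).det|) • (lieFinBasisC N Jw).addHaar := rfl

/-- Two bases with the same index type: `B′.addHaar = |B.det B′|⁻¹ • B.addHaar`. [cite: Knapp2002, VIII §2] -/
theorem addHaar_eq_smul_addHaarC {ι : Type} [Fintype ι] (B B' : Module.Basis ι ℝ (skewC N Jw)) :
    B'.addHaar = (ENNReal.ofReal |B.det B'|)⁻¹ • B.addHaar := by
  haveI : FiniteDimensional ℝ (Matrix (Fin N) (Fin N) ℂ) := finiteDimensional_matrixC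
  have hdet : B.det B' ≠ 0 := (B.isUnit_det B').ne_zero
  have h0 : ENNReal.ofReal |B.det B'| ≠ 0 := by
    rw [Ne, ENNReal.ofReal_eq_zero, not_le]; exact abs_pos.2 hdet
  haveI : IsAddHaarMeasure ((ENNReal.ofReal |B.det B'|)⁻¹ • B.addHaar) :=
    IsAddHaarMeasure.smul _ (ENNReal.inv_ne_zero.2 ENNReal.ofReal_ne_top) (ENNReal.inv_ne_top.2 h0)
  rw [Module.Basis.addHaar_eq_iff]
  rw [Measure.smul_apply, smul_eq_mul, Module.Basis.coe_parallelepiped, addHaar_parallelepiped, ENNReal.inv_mul_cancel h0 ENNReal.ofReal_ne_top]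

/-- **BASIS INDEPENDENCE**: for EVERY finite basis `B` of `𝔲(Jw)`, `lieStdLebesgueC = √|det β(B_i, B_j)| • B.addHaar`. [cite: Macdonald1980, p. 93] [cite: Knapp2002, VIII §2] -/
theorem lieStdLebesgueC_eq_smul_addHaar {ι : Type} [Fintype ι] (B : Module.Basis ι ℝ (skewC N Jw)) :
    lieStdLebesgueC N Jw = ENNReal.ofReal (Real.sqrt |(lieGramC B).det|) • B.addHaar := by
  haveI : FiniteDimensional ℝ (Matrix (Fin N) (Fin N) ℂ) := finiteDimensional_matrixC
  set B₀ := lieFinBasisC N Jw with hB₀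
  let e : Fin (Module.finrank ℝ (skewC N Jw)) ≃ ι := B₀.indexEquiv B
  set B₁ : Module.Basis ι ℝ (skewC N Jw) := B₀.reindex e with hB₁
  have hH : B₁.addHaar = B₀.addHaar := B₀.addHaar_reindex e
  have hG : (lieGramC B₁).det = (lieGramC B₀).det := by
    have : lieGramC B₁ = Matrix.reindex e e (lieGramC B₀) := by
      ext i j; simp only [lieGramC_apply, hB₁, Module.Basis.reindex_apply, Matrix.reindex_apply, Matrix.submatrix_apply]
    rw [this, Matrix.det_reindex_self]
  rw [lieStdLebesgueC_def, ← hB₀, ← hH, ← hG]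
  set P := B₁.toMatrix B with hP
  have hGB : (lieGramC B).det = P.det ^ 2 * (lieGramC B₁).det := by
    rw [lieGramC_basis_change B₁ B, Matrix.det_mul, Matrix.det_mul, Matrix.det_transpose]; ring
  have hdet : B₁.det B = P.det := B₁.det_apply B
  have hP0 : P.det ≠ 0 := by rw [← hdet]; exact (B₁.isUnit_det B).ne_zero
  rw [addHaar_eq_smul_addHaarC B₁ B, hdet, hGB, smul_smul]
  congr 1
  have h0 : ENNReal.ofReal |P.det| ≠ 0 := by
    rw [Ne, ENNReal.ofReal_eq_zero, not_le]; exact abs_pos.2 hP0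
  rw [abs_mul, abs_pow, Real.sqrt_mul (pow_nonneg (abs_nonneg _) 2), Real.sqrt_sq (abs_nonneg _), ENNReal.ofReal_mul (abs_nonneg _),
    mul_right_comm, ENNReal.mul_inv_cancel h0 ENNReal.ofReal_ne_top, one_mul]

/-- Under non-degeneracy of the trace form on `𝔲(Jw)`, `lieStdLebesgueC` is an additive Haar (Lebesgue) measure. [cite: Macdonald1980, p. 93] -/
theorem isAddHaarMeasure_lieStdLebesgueC (hnd : lieGramDetC N Jw ≠ 0) : (lieStdLebesgueC N Jw).IsAddHaarMeasure := by
  rw [lieStdLebesgueC_def]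
  refine IsAddHaarMeasure.smul _ ?_ ENNReal.ofReal_ne_top
  rw [Ne, ENNReal.ofReal_eq_zero, not_le]
  exact Real.sqrt_pos.2 (abs_pos.2 hnd)

end TraceForm


/-! ## §2 The weight `w₀(Y) = |det m_Y|⁻¹`, the window, the chart measure -/

section Weight

variable {N : ℕ} {Jw : Matrix (Fin N) (Fin N) ℂ}

/-- For `Y, H ∈ 𝔲(Jw)`, `(1 − Y) H (1 + Y) ∈ 𝔲(Jw)` (`Yᴴ Jw = −Jw Y`, `Hᴴ Jw = −Jw H`; ★ `skewMul_mem` at one place). [cite: Weyl1939, Ch. II §10] -/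
theorem skewMulC_mem {Y H : Matrix (Fin N) (Fin N) ℂ} (hY : Y ∈ skewC N Jw) (hH : H ∈ skewC N Jw) : (1 - Y) * H * (1 + Y) ∈ skewC N Jw := by
  rw [mem_skewC_iff] at hY hH ⊢
  have hY' : Yᴴ * Jw = -(Jw * Y) := eq_neg_of_add_eq_zero_left hY
  have hH' : Hᴴ * Jw = -(Jw * H) := eq_neg_of_add_eq_zero_left hH
  rw [Matrix.conjTranspose_mul, Matrix.conjTranspose_mul, conjTranspose_one_add, conjTranspose_one_sub]
  have e1 : (1 - Yᴴ) * Jw = Jw * (1 + Y) := by rw [sub_mul, one_mul, hY', mul_add, mul_one, sub_neg_eq_add]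
  have e2 : (1 + Yᴴ) * Jw = Jw * (1 - Y) := by rw [add_mul, one_mul, hY', mul_sub, mul_one, ← sub_eq_add_neg]
  calc (1 + Yᴴ) * (Hᴴ * (1 - Yᴴ)) * Jw + Jw * ((1 - Y) * H * (1 + Y))
      = (1 + Yᴴ) * Hᴴ * ((1 - Yᴴ) * Jw) + Jw * ((1 - Y) * H * (1 + Y)) := by simp only [mul_assoc]
    _ = (1 + Yᴴ) * (Hᴴ * Jw) * (1 + Y) + Jw * ((1 - Y) * H * (1 + Y)) := by rw [e1]; simp only [mul_assoc]
    _ = -(((1 + Yᴴ) * Jw) * H * (1 + Y)) + Jw * ((1 - Y) * H * (1 + Y)) := by rw [hH']; simp only [mul_neg, neg_mul, mul_assoc]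
    _ = 0 := by rw [e2]; simp only [mul_assoc]; exact neg_add_cancel _

variable (N Jw) in
/-- **`m_Y|_𝔲 : 𝔲(Jw) →L[ℝ] 𝔲(Jw)`, `H ↦ (1 − Y) H (1 + Y)`** (the derivative at `0` of left translation by `ĉ(Y)` read in the Cayley chart). [cite: Weyl1939, Ch. II §10] -/
def skewMulLC (Y : skewC N Jw) : skewC N Jw →L[ℝ] skewC N Jw :=
  ((ContinuousLinearMap.mulLeftRight ℝ (Matrix (Fin N) (Fin N) ℂ) (1 - (Y : Matrix (Fin N) (Fin N) ℂ)) (1 + (Y : Matrix (Fin N) (Fin N) ℂ))).comp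
    (skewC N Jw).subtypeL).codRestrict (skewC N Jw) fun H => skewMulC_mem Y.2 H.2

/-- `↑(m_Y H) = (1 − Y) H (1 + Y)`. [cite: Weyl1939, Ch. II §10] -/
@[simp] theorem coe_skewMulLC_apply (Y H : skewC N Jw) :
    ((skewMulLC N Jw Y H : skewC N Jw) : Matrix (Fin N) (Fin N) ℂ) = (1 - (Y : Matrix (Fin N) (Fin N) ℂ)) * (H : Matrix (Fin N) (Fin N) ℂ) * (1 + (Y : Matrix (Fin N) (Fin N) ℂ)) :=
  rfl
/-- `Y ↦ m_Y|_𝔲` is continuous (finite dimension: checked vector by vector). [cite: Weyl1939, Ch. II §10] -/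
theorem continuous_skewMulLC : Continuous (skewMulLC N Jw) := by
  haveI : FiniteDimensional ℝ (Matrix (Fin N) (Fin N) ℂ) := finiteDimensional_matrixC
  refine (continuous_clm_apply (𝕜 := ℝ) (E := skewC N Jw) (F := skewC N Jw)).2 fun H => ?_
  refine Continuous.subtype_mk ?_ _
  change Continuous fun Y : skewC N Jw => (1 - (Y : Matrix (Fin N) (Fin N) ℂ)) * (H : Matrix (Fin N) (Fin N) ℂ) * (1 + (Y : Matrix (Fin N) (Fin N) ℂ))
  exact ((continuous_const.sub continuous_subtype_val).mul continuous_const).mul (continuous_const.add continuous_subtype_val)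

/-- `m_Y|_𝔲` is injective when `1 ± Y` are invertible. [cite: Weyl1939, Ch. II §10] -/
theorem skewMulLC_injective {Y : skewC N Jw} (h : Y ∈ cayleySourceC N Jw) : Function.Injective (skewMulLC N Jw Y) := by
  obtain ⟨u, hu⟩ := id h.1
  obtain ⟨v, hv⟩ := id h.2
  intro H₁ H₂ e
  have e' := congrArg (fun Z : skewC N Jw => (Z : Matrix (Fin N) (Fin N) ℂ)) e
  simp only [coe_skewMulLC_apply, ← hu, ← hv] at e'
  apply Subtype.ext
  have e'' := congrArg (fun Z => ((v⁻¹ : (Matrix (Fin N) (Fin N) ℂ)ˣ) : Matrix (Fin N) (Fin N) ℂ) * Z * ((u⁻¹ : (Matrix (Fin N) (Fin N) ℂ)ˣ) : Matrix (Fin N) (Fin N) ℂ)) e'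
  simpa only [mul_assoc, Units.inv_mul_cancel_left, Units.mul_inv, mul_one] using e''

/-- `det m_Y|_𝔲 ≠ 0` when `1 ± Y` are invertible. [cite: Weyl1939, Ch. II §10] -/
theorem det_skewMulLC_ne_zero {Y : skewC N Jw} (h : Y ∈ cayleySourceC N Jw) : (skewMulLC N Jw Y).det ≠ 0 := by
  haveI : FiniteDimensional ℝ (Matrix (Fin N) (Fin N) ℂ) := finiteDimensional_matrixC
  intro h0
  have h1 := (LinearMap.det_eq_zero_iff_ker_ne_bot (f := ((skewMulLC N Jw Y : skewC N Jw →L[ℝ] skewC N Jw) : skewC N Jw →ₗ[ℝ] skewC N Jw))).1 h0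
  exact h1 (LinearMap.ker_eq_bot.2 (skewMulLC_injective h))

/-- `Y ↦ det m_Y|_𝔲` is continuous. [cite: Weyl1939, Ch. II §10] -/
theorem continuous_det_skewMulLC : Continuous fun Y : skewC N Jw => (skewMulLC N Jw Y).det :=
  ContinuousLinearMap.continuous_det.comp continuous_skewMulLC

variable (N Jw) in
/-- **THE CAYLEY WEIGHT** `w₀(Y) = |det m_Y|_𝔲|⁻¹` at one place (★ `cayleyWeight`). [cite: Weyl1939, Ch. II §10] -/
def cayleyWeightC (Y : skewC N Jw) : ℝ := |(skewMulLC N Jw Y).det|⁻¹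

/-- Unfolding `cayleyWeightC`. [cite: Weyl1939, Ch. II §10] -/
theorem cayleyWeightC_def (Y : skewC N Jw) : cayleyWeightC N Jw Y = |(skewMulLC N Jw Y).det|⁻¹ := rfl
/-- The weight is positive on the source. [cite: Weyl1939, Ch. II §10] -/
theorem cayleyWeightC_pos {Y : skewC N Jw} (h : Y ∈ cayleySourceC N Jw) : 0 < cayleyWeightC N Jw Y := inv_pos.2 (abs_pos.2 (det_skewMulLC_ne_zero h))
/-- The weight is continuous on the source. [cite: Weyl1939, Ch. II §10] -/
theorem continuousOn_cayleyWeightC : ContinuousOn (cayleyWeightC N Jw) (cayleySourceC N Jw) := by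
  refine ContinuousOn.inv₀ (continuous_det_skewMulLC.abs.continuousOn) fun Y hY => ?_
  exact (abs_pos.2 (det_skewMulLC_ne_zero hY)).ne'

/-- The weight is measurable. [cite: Helgason2000, Ch. I §1 Thm. 1.14 p. 96] -/
theorem measurable_cayleyWeightC [MeasurableSpace (skewC N Jw)] [BorelSpace (skewC N Jw)] : Measurable (cayleyWeightC N Jw) :=
  (continuous_det_skewMulLC.abs.measurable).inv

/-- Some closed ball around `0` lies in the chart source (the source is open and contains `0`). [cite: Helgason2000, Ch. I §1 Thm. 1.14 p. 96] -/
theorem exists_closedBall_subset_cayleySourceC : ∃ r : ℝ, 0 < r ∧ Metric.closedBall (0 : skewC N Jw) r ⊆ cayleySourceC N Jw := by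
  obtain ⟨ε, hε, hball⟩ := Metric.isOpen_iff.1 (isOpen_cayleySourceC (N := N) (Jw := Jw)) 0 zero_mem_cayleySourceC
  exact ⟨ε / 2, half_pos hε, (Metric.closedBall_subset_ball (half_lt_self hε)).trans hball⟩

variable (N Jw) in
/-- The radius of the Cayley window of record. [cite: Helgason2000, Ch. I §1 Thm. 1.14 p. 96] -/
def windowRadiusC : ℝ := Classical.choose (exists_closedBall_subset_cayleySourceC (N := N) (Jw := Jw))

/-- The window radius is positive. [cite: Helgason2000, Ch. I §1 Thm. 1.14 p. 96] -/
theorem windowRadiusC_pos : 0 < windowRadiusC N Jw := (Classical.choose_spec (exists_closedBall_subset_cayleySourceC (N := N) (Jw := Jw))).1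
/-- The closed ball of the window radius lies in the chart source. [cite: Helgason2000, Ch. I §1 Thm. 1.14 p. 96] -/
theorem closedBall_windowRadiusC_subset : Metric.closedBall (0 : skewC N Jw) (windowRadiusC N Jw) ⊆ cayleySourceC N Jw :=
  (Classical.choose_spec (exists_closedBall_subset_cayleySourceC (N := N) (Jw := Jw))).2

variable (N Jw) in
/-- The Cayley window of record in `𝔲(Jw)`: the open ball of radius `windowRadiusC`. [cite: Helgason2000, Ch. I §1 Thm. 1.14 p. 96] -/
def windowC : Set (skewC N Jw) := Metric.ball 0 (windowRadiusC N Jw)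

/-- The window is open. [cite: Helgason2000, Ch. I §1 Thm. 1.14 p. 96] -/
theorem isOpen_windowC : IsOpen (windowC N Jw) := Metric.isOpen_ball
/-- `0` lies in the window. [cite: Helgason2000, Ch. I §1 Thm. 1.14 p. 96] -/
theorem zero_mem_windowC : (0 : skewC N Jw) ∈ windowC N Jw := Metric.mem_ball_self windowRadiusC_pos
/-- The window lies in the chart source. [cite: Helgason2000, Ch. I §1 Thm. 1.14 p. 96] -/
theorem windowC_subset_cayleySourceC : windowC N Jw ⊆ cayleySourceC N Jw := Metric.ball_subset_closedBall.trans closedBall_windowRadiusC_subset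
/-- The chart image of the window is open in `U(Jw)(ℂ)`. [cite: Helgason2000, Ch. I §1 Thm. 1.14 p. 96] -/
theorem isOpen_image_windowC : IsOpen (cayleyChartC N Jw '' windowC N Jw) := isOpen_image_cayleyChartC windowC_subset_cayleySourceC isOpen_windowC
/-- The chart image of the window is non-empty (`ĉ 0 = 1`). [cite: Helgason2000, Ch. I §1 Thm. 1.14 p. 96] -/
theorem image_windowC_nonempty : (cayleyChartC N Jw '' windowC N Jw).Nonempty := ⟨_, ⟨0, zero_mem_windowC, rfl⟩⟩
/-- The chart image of the window is relatively compact. [cite: Helgason2000, Ch. I §1 Thm. 1.14 p. 96] -/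
theorem isCompact_closure_image_windowC : IsCompact (closure (cayleyChartC N Jw '' windowC N Jw)) := by
  haveI : FiniteDimensional ℝ (Matrix (Fin N) (Fin N) ℂ) := finiteDimensional_matrixC
  have hK : IsCompact (cayleyChartC N Jw '' Metric.closedBall 0 (windowRadiusC N Jw)) :=
    (isCompact_closedBall (0 : skewC N Jw) _).image_of_continuousOn (continuousOn_cayleyChartC.mono closedBall_windowRadiusC_subset)
  exact hK.closure_of_subset (Set.image_mono Metric.ball_subset_closedBall)

variable [MeasurableSpace (skewC N Jw)] [BorelSpace (skewC N Jw)] [MeasurableSpace (GL (Fin N) ℂ)] [BorelSpace (GL (Fin N) ℂ)]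

variable (N Jw) in
/-- The chart measure on `U(Jw)(ℂ)`: `ĉ_*(w₀ · λ|_{V₀})` (★ `cayleyChartMeasure` at one place). [cite: Helgason2000, Ch. I §1 Thm. 1.14 (13) p. 96] -/
def cayleyChartMeasureC (lam : Measure (skewC N Jw)) (V₀ : Set (skewC N Jw)) : Measure (unitaryGroupOfForm (starRingEnd ℂ) Jw) :=
  Measure.map (cayleyChartC N Jw) ((lam.restrict V₀).withDensity fun X => ENNReal.ofReal (cayleyWeightC N Jw X))

/-- The chart measure of a measurable set: `ν(S) = ∫_{ĉ⁻¹ S ∩ V₀} w₀ dλ`. [cite: Helgason2000, Ch. I §1 Thm. 1.14 (13) p. 96] -/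
theorem cayleyChartMeasureC_apply (lam : Measure (skewC N Jw)) (V₀ : Set (skewC N Jw)) {S : Set (unitaryGroupOfForm (starRingEnd ℂ) Jw)} (hS : MeasurableSet S) :
    cayleyChartMeasureC N Jw lam V₀ S = ∫⁻ X in cayleyChartC N Jw ⁻¹' S ∩ V₀, ENNReal.ofReal (cayleyWeightC N Jw X) ∂lam := by
  rw [cayleyChartMeasureC, Measure.map_apply measurable_cayleyChartC hS, withDensity_apply _ (measurable_cayleyChartC hS),
    Measure.restrict_restrict (measurable_cayleyChartC hS)]

/-- The chart measure of the window is `∫_{W} w₀ dλ`. [cite: Helgason2000, Ch. I §1 Thm. 1.14 p. 96] -/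
theorem cayleyChartMeasureC_image_window (lam : Measure (skewC N Jw)) :
    cayleyChartMeasureC N Jw lam (windowC N Jw) (cayleyChartC N Jw '' windowC N Jw) = ∫⁻ X in windowC N Jw, ENNReal.ofReal (cayleyWeightC N Jw X) ∂lam := by
  have hVW : cayleyChartC N Jw ⁻¹' (cayleyChartC N Jw '' windowC N Jw) ∩ windowC N Jw = windowC N Jw := Set.inter_eq_right.2 fun X hX => ⟨X, hX, rfl⟩
  rw [cayleyChartMeasureC_apply lam _ isOpen_image_windowC.measurableSet, hVW]

/-- `ν(W) ≠ 0` for an additive Haar `λ`: the weight is positive on the window. [cite: Helgason2000, Ch. I §1 Thm. 1.14 p. 96] -/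
theorem cayleyChartMeasureC_image_window_ne_zero (lam : Measure (skewC N Jw)) [lam.IsAddHaarMeasure] :
    cayleyChartMeasureC N Jw lam (windowC N Jw) (cayleyChartC N Jw '' windowC N Jw) ≠ 0 := by
  rw [cayleyChartMeasureC_image_window lam]
  refine ne_of_gt ?_
  rw [lintegral_pos_iff_support measurable_cayleyWeightC.ennreal_ofReal, Measure.restrict_apply' isOpen_windowC.measurableSet]
  have hsub : windowC N Jw ⊆ (Function.support fun X => ENNReal.ofReal (cayleyWeightC N Jw X)) ∩ windowC N Jw :=
    fun X hX => ⟨(ENNReal.ofReal_pos.2 (cayleyWeightC_pos (windowC_subset_cayleySourceC hX))).ne', hX⟩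
  exact (isOpen_windowC.measure_pos lam ⟨0, zero_mem_windowC⟩).trans_le (measure_mono hsub)

/-- `ν(W) ≠ ∞` for `λ` finite on compacta: the weight is bounded on the closed ball. [cite: Helgason2000, Ch. I §1 Thm. 1.14 p. 96] -/
theorem cayleyChartMeasureC_image_window_ne_top (lam : Measure (skewC N Jw)) [IsFiniteMeasureOnCompacts lam] :
    cayleyChartMeasureC N Jw lam (windowC N Jw) (cayleyChartC N Jw '' windowC N Jw) ≠ ⊤ := by
  haveI : FiniteDimensional ℝ (Matrix (Fin N) (Fin N) ℂ) := finiteDimensional_matrixC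
  obtain ⟨X₀, -, hmax⟩ := (isCompact_closedBall (0 : skewC N Jw) (windowRadiusC N Jw)).exists_isMaxOn
    ⟨0, Metric.mem_closedBall_self windowRadiusC_pos.le⟩ (continuousOn_cayleyWeightC.mono closedBall_windowRadiusC_subset)
  rw [cayleyChartMeasureC_image_window lam]
  refine ne_of_lt ?_
  calc ∫⁻ X in windowC N Jw, ENNReal.ofReal (cayleyWeightC N Jw X) ∂lam
      ≤ ∫⁻ X in windowC N Jw, ENNReal.ofReal (cayleyWeightC N Jw X₀) ∂lam :=
        setLIntegral_mono measurable_const fun X hX => ENNReal.ofReal_le_ofReal (hmax (Metric.ball_subset_closedBall hX))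
    _ = ENNReal.ofReal (cayleyWeightC N Jw X₀) * lam (windowC N Jw) := setLIntegral_const _ _
    _ < ⊤ := ENNReal.mul_lt_top ENNReal.ofReal_lt_top
        ((measure_mono Metric.ball_subset_closedBall).trans_lt (isCompact_closedBall (0 : skewC N Jw) _).measure_lt_top)

end Weight

/-! ## §3 The top-form-normalised Haar measure of `U(Jw)(ℂ)` and of the factor `U(σ_w H)(ℂ)` of a CM unitary group -/

section Haar

variable (N : ℕ) (Jw : Matrix (Fin N) (Fin N) ℂ) [MeasurableSpace (GL (Fin N) ℂ)] [BorelSpace (GL (Fin N) ℂ)]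

/-- **THE TOP-FORM-NORMALISED HAAR MEASURE OF `U(Jw)(ℂ)`** (one archimedean factor): `(ν(W) ∕ haar(ĉ '' W)) • Measure.haar` for Mathlib's Haar measure of record on the
locally compact group `U(Jw)(ℂ)` (★ `locallyCompactSpace_unitaryGroupOfForm_complex`), `W` the Cayley window, `ν` the chart measure of the canonical Lebesgue measure —
the one-place reading of ★ `archTopFormHaar` («`2^{−d}|Ω_{Jw}|`»). [cite: Rogawski1990, §1.7 p. 6] [cite: Helgason2000, Ch. I §1 Thm. 1.14 p. 96] [cite: Macdonald1980, p. 93] -/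
def localTopFormHaar : Measure (unitaryGroupOfForm (starRingEnd ℂ) Jw) :=
  letI : MeasurableSpace (skewC N Jw) := borel _
  haveI : BorelSpace (skewC N Jw) := ⟨rfl⟩
  haveI := locallyCompactSpace_unitaryGroupOfForm_complex (n := Fin N) Jw
  (cayleyChartMeasureC N Jw (lieStdLebesgueC N Jw) (windowC N Jw) (cayleyChartC N Jw '' windowC N Jw) /
      Measure.haar (cayleyChartC N Jw '' windowC N Jw)) • Measure.haar

variable {N Jw}

/-- Unfolding `localTopFormHaar`. [cite: Helgason2000, Ch. I §1 Thm. 1.14 p. 96] -/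
theorem localTopFormHaar_def :
    localTopFormHaar N Jw =
      letI : MeasurableSpace (skewC N Jw) := borel _
      haveI : BorelSpace (skewC N Jw) := ⟨rfl⟩
      haveI := locallyCompactSpace_unitaryGroupOfForm_complex (n := Fin N) Jw
      (cayleyChartMeasureC N Jw (lieStdLebesgueC N Jw) (windowC N Jw) (cayleyChartC N Jw '' windowC N Jw) /
          Measure.haar (cayleyChartC N Jw '' windowC N Jw)) • Measure.haar := rfl

omit [BorelSpace (GL (Fin N) ℂ)] in
/-- `0 < μ(ĉ(W))` for every Haar measure `μ`. [cite: Helgason2000, Ch. I §1 Thm. 1.14 p. 96] -/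
theorem haar_image_windowC_ne_zero (μ : Measure (unitaryGroupOfForm (starRingEnd ℂ) Jw)) [μ.IsHaarMeasure] : μ (cayleyChartC N Jw '' windowC N Jw) ≠ 0 :=
  (isOpen_image_windowC.measure_pos μ image_windowC_nonempty).ne'

omit [BorelSpace (GL (Fin N) ℂ)] in
/-- `μ(ĉ(W)) < ∞` for every Haar measure `μ`. [cite: Helgason2000, Ch. I §1 Thm. 1.14 p. 96] -/
theorem haar_image_windowC_ne_top (μ : Measure (unitaryGroupOfForm (starRingEnd ℂ) Jw)) [μ.IsHaarMeasure] : μ (cayleyChartC N Jw '' windowC N Jw) ≠ ⊤ :=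
  ((measure_mono subset_closure).trans_lt isCompact_closure_image_windowC.measure_lt_top).ne

/-- **`localTopFormHaar` IS A HAAR MEASURE** (under non-degeneracy of the trace form on `𝔲(Jw)`): a positive finite multiple of `Measure.haar`.
[cite: Helgason2000, Ch. I §1 Thm. 1.14 p. 96] [cite: Rogawski1990, §1.7 p. 6] -/
theorem isHaarMeasure_localTopFormHaar (hnd : lieGramDetC N Jw ≠ 0) : (localTopFormHaar N Jw).IsHaarMeasure := by
  letI : MeasurableSpace (skewC N Jw) := borel _
  haveI : BorelSpace (skewC N Jw) := ⟨rfl⟩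
  haveI := locallyCompactSpace_unitaryGroupOfForm_complex (n := Fin N) Jw
  haveI := isAddHaarMeasure_lieStdLebesgueC (N := N) (Jw := Jw) hnd
  rw [localTopFormHaar_def]
  refine IsHaarMeasure.smul (μ := (Measure.haar : Measure (unitaryGroupOfForm (starRingEnd ℂ) Jw))) ?_ ?_
  · exact (ENNReal.div_pos_iff.2 ⟨cayleyChartMeasureC_image_window_ne_zero _, haar_image_windowC_ne_top (Measure.haar : Measure (unitaryGroupOfForm (starRingEnd ℂ) Jw))⟩).ne'
  · exact ENNReal.div_ne_top (cayleyChartMeasureC_image_window_ne_top _) (haar_image_windowC_ne_zero (Measure.haar : Measure (unitaryGroupOfForm (starRingEnd ℂ) Jw)))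

/-- **THE WINDOW VALUE, BY DEFINITION**: `localTopFormHaar (ĉ '' W) = ν(W)` (the normalising constant is `ν(W) ∕ haar(ĉ '' W)`).  The full window identity
`μ|_{ĉ(V₀)} = ĉ_*(w₀·λ|_{V₀})` is U2's corollary (slice of the product theorem), not this file's. [cite: Helgason2000, Ch. I §1 Thm. 1.14 p. 96] -/
theorem localTopFormHaar_image_window :
    localTopFormHaar N Jw (cayleyChartC N Jw '' windowC N Jw) =
      (letI : MeasurableSpace (skewC N Jw) := borel _
       haveI : BorelSpace (skewC N Jw) := ⟨rfl⟩
       cayleyChartMeasureC N Jw (lieStdLebesgueC N Jw) (windowC N Jw) (cayleyChartC N Jw '' windowC N Jw)) := by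
  letI : MeasurableSpace (skewC N Jw) := borel _
  haveI : BorelSpace (skewC N Jw) := ⟨rfl⟩
  haveI := locallyCompactSpace_unitaryGroupOfForm_complex (n := Fin N) Jw
  rw [localTopFormHaar_def, Measure.smul_apply, smul_eq_mul,
    ENNReal.div_mul_cancel (haar_image_windowC_ne_zero (Measure.haar : Measure (unitaryGroupOfForm (starRingEnd ℂ) Jw))) (haar_image_windowC_ne_top (Measure.haar : Measure (unitaryGroupOfForm (starRingEnd ℂ) Jw)))]

end Haar


end UnitaryArchLocalTopForm

end Literature.NumberTheory.Weil1964

end
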